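import Summits.RiemannHypothesis.RiemannHypothesis.Theorems.GroundBartaEvenWinsBeyondArchLatticeRippleSum
import Summits.RiemannHypothesis.RiemannHypothesis.Theorems.GroundBartaEvenWinsBeyondArchPhantomLevelCosPoly
import HarnessLib

/-!
# RiemannHypothesis / GroundBarta machinery — phantom chain XT80M4: the ripple list and the tail LEVEL 2116/1000 of `w₂₃ + P` beyond `T = 80`

Helper file (`--supports stmt-RiemannHypothesis-18085 --as helper`), RH-free; seat rh-explicit-weil-6 (CALIBRATION certificate M80X = STEP-0 row
B-W-format-A′, memo `run/shared/lean/pub/rh-explicit/WEIL6-APRIME.md` §1.1).  The minimal separable 4-harmonic phantom of M80X as a ripple list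
`xt80m4Rs = [(3,0,23811/2¹⁶), (4,0,−11087/2¹⁶), (0,2,45938/2¹⁶), (0,3,−14183/2¹⁶)]` (format `(j, k, A)` ↦ `A cos(t (j log 2 + k log 3))` of
`…LatticeRippleSum.lean`, seat weil-1), the identity `ripplesVal xt80m4Rs = sepLevelM80X.phantom` with the kernel level certificate of
`…PhantomLevelCosPoly.lean`, and hence **`xt80m4Level`**: `∀ |t| ≥ 80, 2116/1000 ≤ w₂₃(t) + ripplesVal xt80m4Rs t` — the `hlevel` hypothesis of the
`WeilCert23X` soundness theorems for the calibration certificate. Proved; no named facts.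
-/

set_option linter.dupNamespace false

noncomputable section

namespace Summit.RiemannHypothesis.RiemannHypothesis.Theorems.EvenWinsBeyondArch

open Literature.NumberTheory.LFunctions

/-- The ripple list `(j, k, A)` of the M80X phantom: harmonics `3, 4` of `t log 2` and `2, 3` of `t log 3` (all frequencies `≥ 2·(4023/5000)`). [folklore] -/
def xt80m4Rs : List (ℤ × ℤ × ℚ) :=
  [(3, 0, (23811 : ℚ) / 65536), (4, 0, -((11087 : ℚ) / 65536)), (0, 2, (45938 : ℚ) / 65536), (0, 3, -((14183 : ℚ) / 65536))]

/-- The XT80M4 ripple sum is the phantom of the level certificate `sepLevelM80X`. [folklore] -/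
theorem ripplesVal_xt80m4Rs (t : ℝ) : ripplesVal xt80m4Rs t = sepLevelM80X.phantom t := by
  simp only [ripplesVal, xt80m4Rs, rippleFreq, SepLevelCP.phantom, sepPhantomZ, harmSum, sepLevelM80X,
    List.map_cons, List.map_nil, List.sum_cons, List.sum_nil, List.length_cons, List.length_nil,
    Finset.sum_range_succ, Finset.sum_range_zero, List.getD_cons_zero, List.getD_cons_succ]
  push_cast
  ring_nf

/-- **Tail level of the XT80M4 phantom-modified two-prime weight**: for every `|t| ≥ 80`, `2116/1000 ≤ w₂₃(t) + P(t)`. [folklore] -/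
theorem xt80m4Level (t : ℝ) (ht : (((80 : ℚ)) : ℝ) ≤ |t|) :
    (((2116 / 1000 : ℚ)) : ℝ) ≤ weilTwoPrimeWeight t + ripplesVal xt80m4Rs t := by
  rw [ripplesVal_xt80m4Rs]
  exact level_M80X (by exact_mod_cast ht)

end Summit.RiemannHypothesis.RiemannHypothesis.Theorems.EvenWinsBeyondArch

end
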